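import Mathlib
import HarnessLib
import Literature.Probability.MarkovChains.IsingGlauber
import Literature.Probability.MarkovChains.PositiveCorrelations

/-!
# The ferromagnetic Ising Gibbs measure has positive correlations (FKG 1971 §3.1; Levin–Peres–Wilmer Example 22.15)

HONEST FRAMING: exact (Metropolis-corrected) sampling algorithms for lattice gauge theory; figures
of merit are autocorrelation/cost numbers at stated couplings and volumes; no continuum-physics claim.

Conventions of `IsingGlauber.lean` (`isingEnergy G σ = −½ Σ_v Σ_{u ∼ v} σ(v)σ(u)` on a finite simple
graph `G`, spins `σ : V → ℤˣ`; `gibbsLaw G β σ = e^{−β H(σ)}/Z(β)`, eq. (3.9)) and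
`PositiveCorrelations.lean` (`HasPositiveCorrelations`, FKG's Proposition 1).  The configuration space
`{−1,+1}^V` carries the coordinate-wise order (`ℤˣ` ordered by its value in `ℤ`, `−1 < +1`), a finite
distributive lattice with `(σ ∧ τ)(v) = min(σ(v), τ(v))`, `(σ ∨ τ)(v) = max(σ(v), τ(v))`.  Sources:
C. M. Fortuin, P. W. Kasteleyn, J. Ginibre, Comm. Math. Phys. 22 (1971) 89–103
[FortuinKasteleynGinibreCMP1971], §3.1 "Lattice gas and Ising spin system" (pp. 98–99: for two-body
interactions condition (F) "reduces to the condition `J(r,s) ≥ 0` for all `(r,s)`", whence Proposition 1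
and eq. (3.21) `⟨σ_rσ_s⟩ − ⟨σ_r⟩⟨σ_s⟩ ≥ 0`); D. A. Levin, Y. Peres (with E. L. Wilmer), *Markov Chains
and Mixing Times*, 2nd ed. [LevinPeres2017], §22.4 Example 22.15 (p. 311: "the Ising model … has
positive correlations", proved there through the Harris inequality and the monotone Glauber coupling).
Everything is PROVED (0 named facts).  RELATION TO THE TREE (declared): the FKG inequality for the
finite-volume Ising model WITH boundary condition and magnetic field, in the `SpinConfig`/
`isingHamiltonian` vocabulary of `Literature/Probability/LatticeModels/`, is already proved in
`LatticeModels/IsingFKG.lean` (`ising_fkg_holds`, same Mathlib `fkg` core); this file is the instance for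
the `gibbsLaw G β` of the Markov-chain chapter (free boundary, no field, energy `isingEnergy G` of
`IsingGlauber.lean`), i.e. the statement the monotone-chain files (`MonotoneSecondEigenfunction`,
Theorem 22.16 / Lemma 22.18 applications) consume; no bridge between the two encodings is typed.

* `min_mul_min_add_max_mul_max` — the two-point rearrangement
  `min(a,c)min(b,d) + max(a,c)max(b,d) ≥ ab + cd` [cite: FortuinKasteleynGinibreCMP1971, §3.1
  (condition (F) for a two-body term `J σ_rσ_s`, `J ≥ 0`)];
* `isingEnergy_inf_add_sup_le` — **submodularity of the ferromagnetic energy**: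
  `H(σ ∧ τ) + H(σ ∨ τ) ≤ H(σ) + H(τ)` [cite: FortuinKasteleynGinibreCMP1971, §3.1 (two-body
  ferromagnetic interactions satisfy (F), i.e. `e^{−βH}` satisfies condition (A) of Prop. 1)];
* `gibbsLaw_latticeCondition` — FKG's condition (A) for the Gibbs weight at `β ≥ 0`:
  `μ(σ)μ(τ) ≤ μ(σ ∧ τ)μ(σ ∨ τ)` [cite: FortuinKasteleynGinibreCMP1971, §2 eq. (2.1) with §3.1];
* **`LevinPeres2017_example_22_15`** — for `β ≥ 0` the Ising Gibbs measure has positive correlations: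
  `E_μ(fg) ≥ E_μ(f)E_μ(g)` for all increasing `f, g` [cite: LevinPeres2017, §22.4 Example 22.15]
  [cite: FortuinKasteleynGinibreCMP1971, §3.1 eq. (3.21)] — DECLARED DEVIATION: obtained from FKG's
  Proposition 1 (the route of the 1971 paper) rather than from the Harris inequality and the grand
  coupling of Glauber updates used in the book's Example 22.15.

Context (cell pub-lqcd, venture LatticeQCDFlow): positivity of connected correlations of increasing
observables for ferromagnetic lattice measures — the property that makes heat-bath dynamics of such
models monotone-analysable (censoring, Theorem 22.16) and that fixes the sign of covariances entering
integrated autocorrelation times of magnetisation-like observables.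
-/

namespace Literature.Probability.MarkovChains

open Finset

/-! ## The two-point rearrangement and submodularity of the energy -/

/-- `min(a,c)·min(b,d) + max(a,c)·max(b,d) ≥ ab + cd` for reals — the reason a ferromagnetic pair
interaction is log-supermodular. [cite: FortuinKasteleynGinibreCMP1971, §3.1 (two-body interactions,
`J(r,s) ≥ 0`, satisfy condition (F))] -/
theorem min_mul_min_add_max_mul_max (a b c d : ℝ) :
    a * b + c * d ≤ min a c * min b d + max a c * max b d := by
  rcases le_total a c with hac | hca <;> rcases le_total b d with hbd | hdb
  · rw [min_eq_left hac, min_eq_left hbd, max_eq_right hac, max_eq_right hbd]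
  · rw [min_eq_left hac, min_eq_right hdb, max_eq_right hac, max_eq_left hdb]
    nlinarith [mul_nonneg (sub_nonneg.mpr hac) (sub_nonneg.mpr hdb)]
  · rw [min_eq_right hca, min_eq_left hbd, max_eq_left hca, max_eq_right hbd]
    nlinarith [mul_nonneg (sub_nonneg.mpr hca) (sub_nonneg.mpr hbd)]
  · rw [min_eq_right hca, min_eq_right hdb, max_eq_left hca, max_eq_left hdb]
    linarith

variable {V : Type*} [Fintype V] [DecidableEq V] (G : SimpleGraph V) [DecidableRel G.Adj]

omit [Fintype V] [DecidableEq V] in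
/-- The spin value of a coordinate-wise minimum / maximum (`ℤˣ` is ordered by its integer value).
[folklore] -/
private theorem coe_inf_apply (σ τ : V → ℤˣ) (v : V) :
    (((σ ⊓ τ) v : ℤ) : ℝ) = min (((σ v : ℤ)) : ℝ) (((τ v : ℤ)) : ℝ) := by
  rw [Pi.inf_apply]
  rcases le_total (σ v) (τ v) with h | h
  · rw [inf_eq_left.mpr h, min_eq_left (by exact_mod_cast Units.val_le_val.mpr h)]
  · rw [inf_eq_right.mpr h, min_eq_right (by exact_mod_cast Units.val_le_val.mpr h)]

omit [Fintype V] [DecidableEq V] in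
/-- The spin value of a coordinate-wise maximum. [folklore] -/
private theorem coe_sup_apply (σ τ : V → ℤˣ) (v : V) :
    (((σ ⊔ τ) v : ℤ) : ℝ) = max (((σ v : ℤ)) : ℝ) (((τ v : ℤ)) : ℝ) := by
  rw [Pi.sup_apply]
  rcases le_total (σ v) (τ v) with h | h
  · rw [sup_eq_right.mpr h, max_eq_right (by exact_mod_cast Units.val_le_val.mpr h)]
  · rw [sup_eq_left.mpr h, max_eq_left (by exact_mod_cast Units.val_le_val.mpr h)]

omit [DecidableEq V] in
/-- **Submodularity of the ferromagnetic Ising energy**: `H(σ ∧ τ) + H(σ ∨ τ) ≤ H(σ) + H(τ)`.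
[cite: FortuinKasteleynGinibreCMP1971, §3.1 (ferromagnetic two-body interactions satisfy condition (F),
equivalently the Boltzmann weight satisfies condition (A))] -/
theorem isingEnergy_inf_add_sup_le (σ τ : V → ℤˣ) :
    isingEnergy G (σ ⊓ τ) + isingEnergy G (σ ⊔ τ) ≤ isingEnergy G σ + isingEnergy G τ := by
  simp only [isingEnergy]
  -- compare the double sums term by term
  have key : ∀ v u,
      (if G.Adj v u then ((σ v : ℤ) : ℝ) * ((σ u : ℤ) : ℝ) else 0)
        + (if G.Adj v u then ((τ v : ℤ) : ℝ) * ((τ u : ℤ) : ℝ) else 0)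
      ≤ (if G.Adj v u then (((σ ⊓ τ) v : ℤ) : ℝ) * (((σ ⊓ τ) u : ℤ) : ℝ) else 0)
        + (if G.Adj v u then (((σ ⊔ τ) v : ℤ) : ℝ) * (((σ ⊔ τ) u : ℤ) : ℝ) else 0) := by
    intro v u
    split_ifs
    · rw [coe_inf_apply, coe_inf_apply, coe_sup_apply, coe_sup_apply]
      exact min_mul_min_add_max_mul_max _ _ _ _
    · simp
  have hsum : (∑ v, ∑ u, if G.Adj v u then ((σ v : ℤ) : ℝ) * ((σ u : ℤ) : ℝ) else 0)
      + (∑ v, ∑ u, if G.Adj v u then ((τ v : ℤ) : ℝ) * ((τ u : ℤ) : ℝ) else 0)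
      ≤ (∑ v, ∑ u, if G.Adj v u then (((σ ⊓ τ) v : ℤ) : ℝ) * (((σ ⊓ τ) u : ℤ) : ℝ) else 0)
        + (∑ v, ∑ u, if G.Adj v u then (((σ ⊔ τ) v : ℤ) : ℝ) * (((σ ⊔ τ) u : ℤ) : ℝ) else 0) := by
    rw [← sum_add_distrib, ← sum_add_distrib]
    refine sum_le_sum fun v _ => ?_
    rw [← sum_add_distrib, ← sum_add_distrib]
    exact sum_le_sum fun u _ => key v u
  linarith

/-! ## FKG's condition (A) and positive correlations -/

variable {G}

/-- **Condition (A) for the Ising Gibbs weight**, `β ≥ 0`: `μ(σ)μ(τ) ≤ μ(σ ∧ τ)μ(σ ∨ τ)`.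
[cite: FortuinKasteleynGinibreCMP1971, §2 eq. (2.1) with §3.1 (ferromagnetic two-body case)] -/
theorem gibbsLaw_latticeCondition {β : ℝ} (hβ : 0 ≤ β) (σ τ : V → ℤˣ) :
    gibbsLaw G β σ * gibbsLaw G β τ ≤ gibbsLaw G β (σ ⊓ τ) * gibbsLaw G β (σ ⊔ τ) := by
  simp only [gibbsLaw, div_mul_div_comm, ← Real.exp_add]
  refine div_le_div_of_nonneg_right (Real.exp_le_exp.mpr ?_) (mul_pos (isingZ_pos β) (isingZ_pos β)).le
  have h := isingEnergy_inf_add_sup_le G σ τ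
  nlinarith

/-- **The ferromagnetic Ising Gibbs measure has positive correlations** (`β ≥ 0`): for all
increasing `f, g : {−1,+1}^V → ℝ`, `E_μ(fg) ≥ E_μ(f) E_μ(g)`.
[cite: LevinPeres2017, §22.4 Example 22.15] [cite: FortuinKasteleynGinibreCMP1971, §3.1 eq. (3.21)
(via Prop. 1)] -/
theorem LevinPeres2017_example_22_15 {β : ℝ} (hβ : 0 ≤ β) :
    HasPositiveCorrelations (gibbsLaw G β) :=
  FortuinKasteleynGinibre1971_prop_1_prob (fun σ => (gibbsLaw_pos β σ).le) (sum_gibbsLaw β)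
    (fun σ τ => gibbsLaw_latticeCondition hβ σ τ)

end Literature.Probability.MarkovChains
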